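import Summits.QuantumFields.YangMills.Theorems.UniversalDetectorHankelTransverseStep
import Summits.QuantumFields.YangMills.Theses.UniversalDetector
import HarnessLib

/-!
# Route `UniversalDetector`, LINE g10-3 «transverse curvature» — the support item `CurvatureEdgeGlue`

Ideator seat ym-idea-8 (generation 10, lens «dual»).  Closes the SUPPORT item
`Summit.QuantumFields.YangMills.Theses.UniversalDetector.CurvatureEdgeGlue` (stmt-QuantumFields-24088):
`SchemeCurvatureLaws → HankelCeiling → SchemeEdgeLaws`, i.e. at one scheme the curvature laws (EDGE ∧ CURV ∧
NONCONTACT) and the proved Hankel ceiling (EDGE ⇒ far-boundedness BDD of all sixteen rescaled plane kernels) give the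
edge laws (EDGE ∧ TRANS ∧ NONCONTACT).  The content is the route-independent theorem `transverse_of_curvature`:
for EVERY compact `G`, lattice representation `r` and unit map `a → 0⁺`,  BDD ∧ CURV ⇒ TRANS with `τ = η/4` and the
LIPSCHITZ modulus `ω(δ) = Λ·δ`.

Mechanism (reflection positivity only).  At a point `w` of an axis segment in the slab `|a·w_k| ≤ η/4` with
`‖a·w‖ ≥ η` some coordinate `i ≠ k` has `|a·w_i| ≥ η/2`; the transposition `(0 i)` makes it the time
(`cov_plane_swap`), the time reflection makes it positive (`cov_plane_zero_neg`), and then the TRANSVERSE STEP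
INEQUALITY `sq_cov_plane_tstep_le` (torus RP Cauchy–Schwarz with the difference observable `P_q(y) − P_q(y+e_k)`)
bounds the squared unit step of the kernel by a far DIAGONAL kernel value (`≤ C a⁸` by BDD, `≥ 0` by RP) times the
transverse CONCAVITY DEFECT of a diagonal kernel at a far axis lag (`≤ M a¹⁰` by CURV): each unit step costs
`a⁹ (C+M)/2`, i.e. `O(a)` after the `a⁻⁸` normalisation, and `n` steps cost `O(a n)`.

HONEST FRAMING: a lattice inequality chain; the dynamical input CURV (an `O(a²)` lattice-dispersion bound) is the
route's open crux `SchemeCurvatureLaws`; no continuum statement, no summit, rung or crux is proved here; not Clay.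
Refs: Fröhlich–Israel–Lieb–Simon, Comm. Math. Phys. 62 (1978) Thm. 2.1; Osterwalder–Seiler, Ann. Phys. 110 (1978) §2;
Glimm–Jaffe, *Quantum Physics* (1987) §6.1.
-/

set_option autoImplicit false

noncomputable section

open MeasureTheory Filter Topology
open Literature.MathematicalPhysics.QuantumFieldTheory Literature.MathematicalPhysics.QuantumLattice
  Literature.Probability.LatticeModels
open Summit.QuantumFields.YangMills.Cruxes.OSLegsFromFemtoAndGap.DlrCollarTransfer
open Summit.QuantumFields.YangMills.Theorems.OSLegsFromFemtoAndGap (permPlane permPlane_valid)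

namespace Summit.QuantumFields.YangMills.Cruxes.UniversalDetectorHankel

/-! ## §22 BDD ∧ CURV ⇒ TRANS, and the route item -/

set_option maxHeartbeats 800000 in
/-- **Transverse modulus from curvature.**  For every compact simple `G`, every lattice representation and every unit
map `a → 0⁺`: far-boundedness (BDD) of the sixteen rescaled plane kernels and the CURVATURE bound (CURV: the
transverse concavity defect of the four diagonal rescaled kernels on the time axis is `O(a²)` at far lags) imply the
TRANSVERSE modulus clause (TRANS) of `SchemeEdgeLaws` with `τ = η/4` and the Lipschitz modulus `ω(δ) = Λ δ`.
No summit, rung or crux is proved. [cite: FrohlichIsraelLiebSimon1978, Thm. 2.1; OsterwalderSeiler1978, §2] -/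
theorem transverse_of_curvature :
    open MeasureTheory Literature.MathematicalPhysics.QuantumFieldTheory Literature.MathematicalPhysics.QuantumLattice Literature.Probability.LatticeModels Summit.QuantumFields.YangMills.Cruxes.OSLegsFromFemtoAndGap.DlrCollarTransfer in ∀ (G : Type) [Group G] [TopologicalSpace G] [IsTopologicalGroup G] [CompactSpace G], letI : MeasurableSpace G := borel G; haveI : BorelSpace G := ⟨rfl⟩; ∀ (r : LatticeRep G) (a : ℝ → ℝ), (∀ β, 0 < a β) → Filter.Tendsto a Filter.atTop (nhds 0) → let ker6 : ℝ → ℕ → Fin 4 × Fin 4 → Fin 4 × Fin 4 → (Fin 4 → ℤ) → ℝ := (fun (β : ℝ) (L : ℕ) (p q : Fin 4 × Fin 4) (z : Fin 4 → ℤ) => (a β)⁻¹ ^ 8 * (torusE G r β L (fun U => plane G r p 0 U * plane G r q z U) - torusE G r β L (plane G r p 0) * torusE G r β L (plane G r q z))); (∀ p q : Fin 4 × Fin 4, p.1 < p.2 → q.1 < q.2 → ∀ η : ℝ, 0 < η → ∃ (C β₅ Λ₅ : ℝ), ∀ β : ℝ, β₅ ≤ β → ∀ L : ℕ, Λ₅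 ≤ a β * L → ∀ z ∈ box 4 L, η ≤ ‖a β • siteToE z‖ → |ker6 β L p q z| ≤ C) → (∀ q : Fin 4 × Fin 4, q.1 < q.2 → ∀ k : Fin 4, k ≠ 0 → ∀ η : ℝ, 0 < η → ∃ (M β₅ Λ₅ : ℝ), ∀ β : ℝ, β₅ ≤ β → ∀ L : ℕ, Λ₅ ≤ a β * L → ∀ s : ℕ, η ≤ a β * s → η ≤ a β * (2 * L + 1 - s) → (a β)⁻¹ ^ 2 * (2 * ker6 β L q q (Pi.single 0 (s : ℤ)) - ker6 β L q q ((Pi.single 0 (s : ℤ) : Fin 4 → ℤ) + Pi.single k 1) - ker6 β L q q ((Pi.single 0 (s : ℤ) : Fin 4 → ℤ) - Pi.single k 1)) ≤ M) → (∀ p q : Fin 4 × Fin 4, p.1 < p.2 → q.1 < q.2 → ∀ η : ℝ, 0 < η → ∃ (τ β₅ Λ₅ : ℝ) (ω : ℝ → ℝ), 0 < τ ∧ Monotone ω ∧ Filter.Tendsto ω (nhdsWithin 0 (Set.Ioi 0)) (nhds 0) ∧ ∀ β : ℝ, β₅ ≤ β → ∀ L : ℕ, Λ₅ ≤ a β *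 L → ∀ (k : Fin 4) (z : Fin 4 → ℤ) (n : ℕ), (∀ j : ℕ, j ≤ n → z + Pi.single k (j : ℤ) ∈ box 4 L ∧ η ≤ ‖a β • siteToE (z + Pi.single k (j : ℤ))‖ ∧ |a β * (z k + j)| ≤ τ) → |ker6 β L p q z - ker6 β L p q (z + Pi.single k (n : ℤ))| ≤ ω (a β * n)) := by
  intro G _ _ _ _
  letI : MeasurableSpace G := borel G
  haveI : BorelSpace G := ⟨rfl⟩
  intro r a ha hlim ker6 hB hK p q hp hq η hη
  simp only [ker6] at hB hK ⊢
  choose! C β₅ Λ₅ hBDD using hB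
  choose! M βM ΛM hCURV using hK
  obtain ⟨βa, hβa⟩ : ∃ βa : ℝ, ∀ β, βa ≤ β → a β ≤ min (η / 4) 1 := by
    have hpos : (0 : ℝ) < min (η / 4) 1 := lt_min (by linarith) one_pos
    exact Filter.eventually_atTop.1 (hlim.eventually (Iic_mem_nhds hpos))
  set η₄ : ℝ := η / 4 with hη₄
  have hη₄pos : 0 < η₄ := by positivity
  set P : Fin 4 → Fin 4 × Fin 4 := fun i => permPlane (Equiv.swap 0 i) p with hP
  set Q : Fin 4 → Fin 4 × Fin 4 := fun i => permPlane (Equiv.swap 0 i) q with hQ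
  have hPv : ∀ i, (P i).1 < (P i).2 := fun i => permPlane_valid _ hp
  have hQv : ∀ i, (Q i).1 < (Q i).2 := fun i => permPlane_valid _ hq
  -- uniform constants: sums over frames and directions of the constants used
  set Cs : ℝ := ∑ i, (|C (P i) (P i) η₄| + |C (Q i) (Q i) η₄|) with hCs
  set Ms : ℝ := ∑ i, ∑ k', (|M (P i) k' η₄| + |M (Q i) k' η₄|) with hMs
  set Bs : ℝ := ∑ i, (|β₅ (P i) (P i) η₄| + |β₅ (Q i) (Q i) η₄| + ∑ k', (|βM (P i) k' η₄| + |βM (Q i) k' η₄|))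
    with hBs
  set Ls : ℝ := ∑ i, (|Λ₅ (P i) (P i) η₄| + |Λ₅ (Q i) (Q i) η₄| + ∑ k', (|ΛM (P i) k' η₄| + |ΛM (Q i) k' η₄|))
    with hLs
  have hCs0 : 0 ≤ Cs := Finset.sum_nonneg fun i _ => by positivity
  have hMs0 : 0 ≤ Ms := Finset.sum_nonneg fun i _ => Finset.sum_nonneg fun k' _ => by positivity
  refine ⟨η / 4, |βa| + Bs, η / 2 + 6 + Ls, fun δ => (Cs + Ms) / 2 * δ, by positivity,
    fun x y hxy => mul_le_mul_of_nonneg_left hxy (by positivity), ?_, ?_⟩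
  · have hc : Continuous fun δ : ℝ => (Cs + Ms) / 2 * δ := continuous_const.mul continuous_id
    have h0 := hc.tendsto 0
    rw [mul_zero] at h0
    exact tendsto_nhdsWithin_of_tendsto_nhds h0
  intro β hβ L hL k z n hseg
  have haβ := ha β
  -- every individual threshold is below the uniform one
  have iB : ∀ i, |β₅ (P i) (P i) η₄| + |β₅ (Q i) (Q i) η₄| + ∑ k', (|βM (P i) k' η₄| + |βM (Q i) k' η₄|) ≤ Bs :=
    fun i => Finset.single_le_sum (f := fun i => |β₅ (P i) (P i) η₄| + |β₅ (Q i) (Q i) η₄| +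
      ∑ k', (|βM (P i) k' η₄| + |βM (Q i) k' η₄|)) (fun i _ => by positivity) (Finset.mem_univ i)
  have iL : ∀ i, |Λ₅ (P i) (P i) η₄| + |Λ₅ (Q i) (Q i) η₄| + ∑ k', (|ΛM (P i) k' η₄| + |ΛM (Q i) k' η₄|) ≤ Ls :=
    fun i => Finset.single_le_sum (f := fun i => |Λ₅ (P i) (P i) η₄| + |Λ₅ (Q i) (Q i) η₄| +
      ∑ k', (|ΛM (P i) k' η₄| + |ΛM (Q i) k' η₄|)) (fun i _ => by positivity) (Finset.mem_univ i)
  have iC : ∀ i, |C (P i) (P i) η₄| + |C (Q i) (Q i) η₄| ≤ Cs :=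
    fun i => Finset.single_le_sum (f := fun i => |C (P i) (P i) η₄| + |C (Q i) (Q i) η₄|)
      (fun i _ => by positivity) (Finset.mem_univ i)
  have iM : ∀ i, ∑ k', (|M (P i) k' η₄| + |M (Q i) k' η₄|) ≤ Ms :=
    fun i => Finset.single_le_sum (f := fun i => ∑ k', (|M (P i) k' η₄| + |M (Q i) k' η₄|))
      (fun i _ => Finset.sum_nonneg fun k' _ => by positivity) (Finset.mem_univ i)
  have iMk : ∀ i k', |M (P i) k' η₄| + |M (Q i) k' η₄| ≤ Ms := fun i k' =>
    (Finset.single_le_sum (f := fun k' => |M (P i) k' η₄| + |M (Q i) k' η₄|) (fun k' _ => by positivity)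
      (Finset.mem_univ k')).trans (iM i)
  have iBk : ∀ i k', |βM (P i) k' η₄| + |βM (Q i) k' η₄| ≤
      ∑ k', (|βM (P i) k' η₄| + |βM (Q i) k' η₄|) := fun i k' =>
    Finset.single_le_sum (f := fun k' => |βM (P i) k' η₄| + |βM (Q i) k' η₄|) (fun k' _ => by positivity)
      (Finset.mem_univ k')
  have iLk : ∀ i k', |ΛM (P i) k' η₄| + |ΛM (Q i) k' η₄| ≤
      ∑ k', (|ΛM (P i) k' η₄| + |ΛM (Q i) k' η₄|) := fun i k' =>
    Finset.single_le_sum (f := fun k' => |ΛM (P i) k' η₄| + |ΛM (Q i) k' η₄|) (fun k' _ => by positivity)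
      (Finset.mem_univ k')
  have hBs0 : 0 ≤ Bs := le_trans (by positivity) (iB 0)
  have hLs0 : 0 ≤ Ls := le_trans (by positivity) (iL 0)
  have hβa' : βa ≤ β := by linarith [le_abs_self βa]
  obtain ⟨haη4, ha1⟩ := le_min_iff.1 (hβa β hβa')
  have hβ0 : 0 ≤ β := by linarith [abs_nonneg βa]
  have haL : η / 2 ≤ a β * L := by linarith
  have hL6 : 6 ≤ L := by
    have h6 : (6 : ℝ) ≤ a β * L := by linarith
    have hL' : a β * L ≤ L := by nlinarith [Nat.cast_nonneg (α := ℝ) L]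
    exact_mod_cast h6.trans hL'
  -- far ceilings of the diagonal kernels in covariance letters
  have farD : ∀ p' : Fin 4 × Fin 4, p'.1 < p'.2 → β₅ p' p' η₄ ≤ β → Λ₅ p' p' η₄ ≤ a β * L →
      ∀ m : ℤ, 0 ≤ m → m ≤ L → η / 4 ≤ a β * m → |diagCov G r β L p' m| ≤ (a β) ^ 8 * |C p' p' η₄| := by
    intro p' hp' hβ' hL' m hm0 hmL hm
    have hbox : (Pi.single 0 m : Site 4) ∈ box 4 L := by
      simp only [box, Fintype.mem_piFinset, Finset.mem_Icc]
      intro j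
      by_cases hj : j = 0
      · subst hj; rw [Pi.single_eq_same]; omega
      · rw [Pi.single_eq_of_ne hj]; omega
    have hfar : η₄ ≤ ‖a β • siteToE (Pi.single 0 m : Site 4)‖ :=
      le_norm_smul_siteToE_of_le_time haβ.le _ (by
        rw [Pi.single_eq_same, abs_of_nonneg (by exact_mod_cast hm0 : (0 : ℝ) ≤ m)]; exact hm)
    exact abs_le_pow_of_abs_inv_pow_mul_le haβ (hBDD p' p' hp' hp' η₄ hη₄pos β hβ' L hL' _ hbox hfar)
  -- far curvature bounds in covariance letters
  have farK : ∀ q' : Fin 4 × Fin 4, q'.1 < q'.2 → ∀ k' : Fin 4, k' ≠ 0 → βM q' k' η₄ ≤ β → ΛM q' k' η₄ ≤ a β * L →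
      ∀ t : ℤ, η / 4 ≤ a β * t → η / 4 ≤ a β * (2 * L + 1 - t) →
        curvDefect G r β L q' (Pi.single k' 1) t ≤ (a β) ^ 10 * |M q' k' η₄| := by
    intro q' hq' k' hk' hβ' hL' t ht ht'
    have ht0 : (0 : ℝ) ≤ t := by
      by_contra h
      push Not at h
      nlinarith
    have ht0' : 0 ≤ t := by exact_mod_cast ht0
    obtain ⟨sN, hsN⟩ : ∃ sN : ℕ, (sN : ℤ) = t := ⟨t.toNat, Int.toNat_of_nonneg ht0'⟩
    subst hsN
    have h := hCURV q' hq' k' hk' η₄ hη₄pos β hβ' L hL' sN (by exact_mod_cast ht) (by exact_mod_cast ht')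
    unfold curvDefect diagCov
    exact defect_le_of_scaled haβ h
  -- thresholds of the frames
  have thrD : ∀ i, β₅ (P i) (P i) η₄ ≤ β ∧ Λ₅ (P i) (P i) η₄ ≤ a β * L ∧ β₅ (Q i) (Q i) η₄ ≤ β ∧
      Λ₅ (Q i) (Q i) η₄ ≤ a β * L := by
    intro i
    have h1 := iB i
    have h2 := iL i
    have s0 : 0 ≤ ∑ k', (|βM (P i) k' η₄| + |βM (Q i) k' η₄|) := Finset.sum_nonneg fun k' _ => by positivity
    have s1 : 0 ≤ ∑ k', (|ΛM (P i) k' η₄| + |ΛM (Q i) k' η₄|) := Finset.sum_nonneg fun k' _ => by positivity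
    refine ⟨?_, ?_, ?_, ?_⟩ <;>
      linarith [le_abs_self (β₅ (P i) (P i) η₄), le_abs_self (β₅ (Q i) (Q i) η₄), le_abs_self (Λ₅ (P i) (P i) η₄),
        le_abs_self (Λ₅ (Q i) (Q i) η₄), abs_nonneg (β₅ (P i) (P i) η₄), abs_nonneg (β₅ (Q i) (Q i) η₄),
        abs_nonneg (Λ₅ (P i) (P i) η₄), abs_nonneg (Λ₅ (Q i) (Q i) η₄), abs_nonneg βa]
  have thrK : ∀ i k', βM (P i) k' η₄ ≤ β ∧ ΛM (P i) k' η₄ ≤ a β * L ∧ βM (Q i) k' η₄ ≤ β ∧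
      ΛM (Q i) k' η₄ ≤ a β * L := by
    intro i k'
    have h1 := iB i
    have h2 := iL i
    have h3 := iBk i k'
    have h4 := iLk i k'
    refine ⟨?_, ?_, ?_, ?_⟩ <;>
      linarith [le_abs_self (βM (P i) k' η₄), le_abs_self (βM (Q i) k' η₄), le_abs_self (ΛM (P i) k' η₄),
        le_abs_self (ΛM (Q i) k' η₄), abs_nonneg (β₅ (P i) (P i) η₄), abs_nonneg (β₅ (Q i) (Q i) η₄),
        abs_nonneg (Λ₅ (P i) (P i) η₄), abs_nonneg (Λ₅ (Q i) (Q i) η₄), abs_nonneg βa,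
        abs_nonneg (βM (P i) k' η₄), abs_nonneg (βM (Q i) k' η₄), abs_nonneg (ΛM (P i) k' η₄),
        abs_nonneg (ΛM (Q i) k' η₄)]
  -- the uniform far bounds of the frame-free step lemma
  have hDP : ∀ (i : Fin 4) (m : ℤ), 0 ≤ m → m ≤ L → η / 4 ≤ a β * m →
      |diagCov G r β L (permPlane (Equiv.swap 0 i) p) m| ≤ (a β) ^ 8 * Cs := fun i m hm0 hmL hm =>
    (farD (P i) (hPv i) (thrD i).1 (thrD i).2.1 m hm0 hmL hm).trans
      (mul_le_mul_of_nonneg_left ((le_add_of_nonneg_right (abs_nonneg _)).trans (iC i)) (by positivity))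
  have hDQ : ∀ (i : Fin 4) (m : ℤ), 0 ≤ m → m ≤ L → η / 4 ≤ a β * m →
      |diagCov G r β L (permPlane (Equiv.swap 0 i) q) m| ≤ (a β) ^ 8 * Cs := fun i m hm0 hmL hm =>
    (farD (Q i) (hQv i) (thrD i).2.2.1 (thrD i).2.2.2 m hm0 hmL hm).trans
      (mul_le_mul_of_nonneg_left ((le_add_of_nonneg_left (abs_nonneg _)).trans (iC i)) (by positivity))
  have hKP : ∀ (i k' : Fin 4), k' ≠ 0 → ∀ t : ℤ, η / 4 ≤ a β * t → η / 4 ≤ a β * (2 * L + 1 - t) →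
      curvDefect G r β L (permPlane (Equiv.swap 0 i) p) (Pi.single k' 1) t ≤ (a β) ^ 10 * Ms :=
    fun i k' hk' t ht ht' =>
      (farK (P i) (hPv i) k' hk' (thrK i k').1 (thrK i k').2.1 t ht ht').trans
        (mul_le_mul_of_nonneg_left ((le_add_of_nonneg_right (abs_nonneg _)).trans (iMk i k')) (by positivity))
  have hKQ : ∀ (i k' : Fin 4), k' ≠ 0 → ∀ t : ℤ, η / 4 ≤ a β * t → η / 4 ≤ a β * (2 * L + 1 - t) →
      curvDefect G r β L (permPlane (Equiv.swap 0 i) q) (Pi.single k' 1) t ≤ (a β) ^ 10 * Ms :=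
    fun i k' hk' t ht ht' =>
      (farK (Q i) (hQv i) k' hk' (thrK i k').2.2.1 (thrK i k').2.2.2 t ht ht').trans
        (mul_le_mul_of_nonneg_left ((le_add_of_nonneg_left (abs_nonneg _)).trans (iMk i k')) (by positivity))
  -- telescoping along the segment; the unit step is `abs_cov_tstep_le`
  induction n with
  | zero => simp
  | succ m ih =>
      have ih' := ih fun j hj => hseg j (by omega)
      obtain ⟨hw1, hw2, hw3⟩ := hseg m (by omega)
      simp only [box, Fintype.mem_piFinset, Finset.mem_Icc] at hw1
      have e : z + Pi.single k (((m + 1 : ℕ)) : ℤ) = z + Pi.single k (m : ℤ) + Pi.single k 1 := by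
        rw [Nat.cast_succ, Pi.single_add, add_assoc]
      rw [e]
      have haη4' : a β ≤ η / 4 := by have h := haη4; rwa [hη₄] at h
      have hw3' : |a β * (((z + Pi.single k (m : ℤ) : Fin 4 → ℤ) k : ℤ) : ℝ)| ≤ η / 4 := by
        rw [Pi.add_apply, Pi.single_eq_same]; push_cast; exact hw3
      have key := abs_cov_tstep_le G r hβ0 hL6 hp hq k (a := a β) (η := η) (C := Cs) (M := Ms) haβ haη4' haL
        hCs0 hMs0 hDP hDQ hKP hKQ _ hw1 hw2 hw3'
      have step : |(a β)⁻¹ ^ 8 * (torusE G r β L (fun U => plane G r p 0 U * plane G r q (z + Pi.single k (m : ℤ)) U) -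
            torusE G r β L (plane G r p 0) * torusE G r β L (plane G r q (z + Pi.single k (m : ℤ)))) -
          (a β)⁻¹ ^ 8 * (torusE G r β L (fun U => plane G r p 0 U *
              plane G r q (z + Pi.single k (m : ℤ) + Pi.single k 1) U) -
            torusE G r β L (plane G r p 0) *
              torusE G r β L (plane G r q (z + Pi.single k (m : ℤ) + Pi.single k 1)))| ≤
          (Cs + Ms) / 2 * a β := by
        rw [← mul_sub, abs_mul, abs_of_pos (pow_pos (inv_pos.2 haβ) 8), inv_pow, ← div_eq_inv_mul,
          div_le_iff₀ (pow_pos haβ 8)]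
        refine key.trans (le_of_eq ?_)
        ring
      have comb := (abs_sub_le _ _ _).trans (add_le_add ih' step)
      refine comb.trans (le_of_eq ?_)
      push_cast
      ring

/-- **LINE g10-3: the support item `CurvatureEdgeGlue` holds** — `SchemeCurvatureLaws → HankelCeiling →
SchemeEdgeLaws`: at the scheme of the curvature laws, the Hankel ceiling turns EDGE into far-boundedness of all plane
kernels, `transverse_of_curvature` turns far-boundedness and CURV into TRANS, and EDGE, NONCONTACT are carried over.
No summit, rung or crux is proved: this closes the support item `UniversalDetector.CurvatureEdgeGlue`
(stmt-QuantumFields-24088) only; the crux `SchemeCurvatureLaws` stays open. [cite: OsterwalderSeiler1978, §2] -/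
theorem universalDetector_curvatureEdgeGlue :
    Summit.QuantumFields.YangMills.Theses.UniversalDetector.CurvatureEdgeGlue := by
  intro hK hC G _ _ _ _ hG
  letI : MeasurableSpace G := borel G
  haveI : BorelSpace G := ⟨rfl⟩
  obtain ⟨r, a, ha, hlim, hEDGE, hCURV, hNC⟩ := hK G hG
  have hBDD := hC G r a ha hlim hEDGE
  exact ⟨r, a, ha, hlim, hEDGE, transverse_of_curvature G r a ha hlim hBDD hCURV, hNC⟩

end Summit.QuantumFields.YangMills.Cruxes.UniversalDetectorHankel

end
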